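import Literature.NumberTheory.EllipticCurves.ShintaniKernelPoisson
import Literature.NumberTheory.EllipticCurves.GaussSumSign
import Literature.NumberTheory.EllipticCurves.TunnellFormsAutomorphy
import Literature.NumberTheory.EllipticCurves.ThetaAutomorphyClosure
import Literature.NumberTheory.EllipticCurves.Gamma0TwoPowerGenerators
import HarnessLib

/-!
# The level-`256` transformation law of the twisted Shintani kernel `K_D`

[[cite: Shintani1975, Prop. 1.6]] [[cite: Shimura1973HalfIntegral, §1]] — for `D` odd and
square-free, `z ↦ K_D(w, z)` (`ShintaniKernelPoisson`) satisfies the `θ`-multiplier law of weight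
`3/2` on `Γ₀(256)` with trivial character:
`K_D(w, γz) θ(z)³ = θ(γz)³ K_D(w, z)` for all `γ ∈ Γ₀(256)` (`isThetaAutomorphic_kerD`).

Proof.  For `D ≡ 3 (mod 4)` the kernel vanishes identically.  For `D ≡ 1 (mod 4)`:
`Γ₀(256)` is generated by `T`, `-1` and the `σ = (a b; 256 d)` with `gcd(a, D) = 1`
(`Gamma0TwoPowerGenerators` plus a shift of `a` by a multiple of `256`), and the set of `γ` satisfying
the law is a subgroup for continuous `K` (`ThetaAutomorphyClosure`; continuity by dominated
convergence, `continuous_genKernel`).  The `T`-law is the integrality `disc ι♮(k)/(256D) = n(v)/D ∈ ℤ`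
on the support of `ω_D`.  For `σ`, `kerD_smul_sigma` gives `K_D(w, σz)` as
`(Im σz)^{1/2}(8192N³)⁻¹ κ(Z') (128N)⁻¹ 𝒦(a,a*) (Im z)^{-1/2} K_D(w, z)` and the tree's theta
multiplier gives `θ(σz) = (2i·256/(256z+d))^{-1/2} G(a; 256) θ(z)`; the identity of the two constants
(`const_identity`) is an explicit computation: `κ(Z')` at `Z' = -1/(256N(256z+d))` in terms of
`β = (i(256 z̄ + d))^{1/2}` (principal branches, all Gaussian parameters have positive real part),
`G(a; 256) = 16(1 + i^a)`, `G(64a; 256D) = 128(1 + i^a)(a/D)√D` (CRT, scaling, Gauss's sign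
`G(1; D) = √D`), `χ₋₄(-a*) = -χ₋₄(a)`, `(-a*/D)(a/D) = 1`.

Everything is proved; no facts are introduced.
-/

noncomputable section

open Complex Real
open scoped MatrixGroups ComplexConjugate

namespace Literature.NumberTheory.EllipticCurves.Shintani

open UpperHalfPlane hiding I
open Literature.NumberTheory.EllipticCurves.ModularForms
open Literature.NumberTheory.EllipticCurves.Tunnell1983 (thetaMul_one_eq_shimuraTheta thetaMul_one_smul)
open Literature.NumberTheory.LFunctions (sum_range_mul_eq_sum_sum)

/-! ### Gauss-sum evaluations -/

/-- **Scaling**: `G(t b; t m) = t G(b; m)` (the terms are `m`-periodic). [folklore] -/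
theorem quadGaussSum_mul_mul {c t m : ℕ} [NeZero c] [NeZero m] (hc : c = t * m) (b : ℤ) :
    quadGaussSum c ((t * b : ℤ)) 0 = t * quadGaussSum m b 0 := by
  subst hc
  have ht0 : t ≠ 0 := fun h ↦ by have := NeZero.ne (t * m); simp [h] at this
  have hm0 : (m : ℂ) ≠ 0 := by exact_mod_cast NeZero.ne m
  have ht0' : (t : ℂ) ≠ 0 := by exact_mod_cast ht0
  rw [quadGaussSum_zero_eq_sum_range, quadGaussSum_zero_eq_sum_range,
    show Finset.range (t * m) = Finset.range (m * t) by rw [mul_comm], sum_range_mul_eq_sum_sum m t,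
    Finset.mul_sum]
  refine Finset.sum_congr rfl fun u _ ↦ ?_
  have hterm : ∀ v ∈ Finset.range t,
      cexp (2 * Real.pi * I * ((t * b * ((u + m * v : ℕ) : ℤ) ^ 2 : ℤ) : ℂ) / (t * m : ℕ)) =
        cexp (2 * Real.pi * I * ((b * (u : ℤ) ^ 2 : ℤ) : ℂ) / m) := by
    intro v _
    refine cexp_eq_cexp_of_sub_eq (b * (2 * u * v + m * v ^ 2)) ?_
    push_cast
    field_simp
    ring
  rw [Finset.sum_congr rfl hterm, Finset.sum_const, Finset.card_range, nsmul_eq_mul]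

/-- `G(a; 256) = 16 (1 + ψ₄(a))` for odd `a` (`G(a; 4m) = 2G(a; m)` thrice, then `G(a; 4)`). [folklore] -/
theorem quadGaussSum_256_of_odd {a : ℤ} (ha : Odd a) :
    quadGaussSum 256 a 0 = 16 * (1 + (ZMod.stdAddChar (a : ZMod 4) : ℂ)) := by
  haveI : NeZero (64 : ℕ) := ⟨by norm_num⟩
  haveI : NeZero (16 : ℕ) := ⟨by norm_num⟩
  have h1 : quadGaussSum 256 a 0 = 2 * quadGaussSum 64 a 0 :=
    quadGaussSum_four_mul' (by norm_num) (by norm_num) ha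
  have h2 : quadGaussSum 64 a 0 = 2 * quadGaussSum 16 a 0 :=
    quadGaussSum_four_mul' (by norm_num) (by norm_num) ha
  have h3 : quadGaussSum 16 a 0 = 2 * quadGaussSum 4 a 0 :=
    quadGaussSum_four_mul' (by norm_num) (by norm_num) ha
  rw [h1, h2, h3, quadGaussSum_four_eq]
  ring

/-- `G(64a; 256D) = 128 (1 + ψ₄(a)) (a/D) √D` for `D ≡ 1 (mod 4)` square-free and `gcd(a, D) = 1`
(CRT, scaling `G(64aD; 256) = 64 G(aD; 4)`, unit squares, `G(a; D) = (a/D) G(1; D)`, Gauss's sign).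
[folklore] -/
theorem quadGaussSum_sixtyfour_mul (D : ℕ) [NeZero D] (hD1 : D % 4 = 1) {a : ℤ}
    (haD : a.gcd D = 1) :
    quadGaussSum (256 * D) (64 * (a : ZMod (256 * D))) 0 =
      128 * (1 + (ZMod.stdAddChar (a : ZMod 4) : ℂ)) * jacobiSym a D * (Real.sqrt D : ℂ) := by
  have hodd : Odd D := Nat.odd_iff.mpr (by omega)
  have h2D : Nat.Coprime 2 D := Nat.coprime_two_left.mpr hodd
  have hcop : Nat.Coprime 256 D := by
    have := Nat.Coprime.pow_left 8 h2D
    norm_num at this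
    exact this
  have e0 : (64 * (a : ZMod (256 * D))) = ((64 * a : ℤ) : ZMod (256 * D)) := by push_cast; ring
  rw [e0, quadGaussSum_mul_of_coprime hcop (64 * a)]
  -- first factor
  have f1 : quadGaussSum 256 (((D : ℤ) * (64 * a) : ℤ) : ZMod 256) 0 =
      64 * (2 + 2 * (ZMod.stdAddChar (a : ZMod 4) : ℂ)) := by
    have h := quadGaussSum_mul_mul (c := 256) (t := 64) (m := 4) (by norm_num) (D * a)
    have e : (((64 : ℕ) : ℤ) * (D * a) : ℤ) = ((D : ℤ) * (64 * a) : ℤ) := by push_cast; ring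
    rw [e] at h
    rw [h, quadGaussSum_four_eq]
    have hD4 : ((D : ℕ) : ZMod 4) = 1 := by
      rw [← ZMod.natCast_mod D 4, hD1]; rfl
    push_cast
    rw [hD4, one_mul]
  -- second factor
  have f2 : quadGaussSum D ((((256 : ℕ) : ℤ) * (64 * a) : ℤ) : ZMod D) 0 =
      jacobiSym a D * (Real.sqrt D : ℂ) := by
    have hu : IsUnit ((128 : ℕ) : ZMod D) := by
      rw [ZMod.isUnit_iff_coprime]
      have := Nat.Coprime.pow_left 7 h2D
      norm_num at this
      exact this
    have : ((((256 : ℕ) : ℤ) * (64 * a) : ℤ) : ZMod D) = ((128 : ℕ) : ZMod D) ^ 2 * (a : ZMod D) := by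
      push_cast; ring
    rw [this, quadGaussSum_unit_sq_mul hu, quadGaussSum_eq_jacobiSym_mul hodd haD,
      quadGaussSum_one_of_mod_four_eq_one hD1]
  rw [f1, f2]
  ring

/-! ### Square roots -/

/-- `(r y)^{1/2} = √r · y^{1/2}` for real `r > 0`. [folklore] -/
theorem cpow_half_ofReal_mul {r : ℝ} (hr : 0 < r) (y : ℂ) :
    ((r : ℂ) * y) ^ (1 / 2 : ℂ) = (Real.sqrt r : ℂ) * y ^ (1 / 2 : ℂ) := by
  rcases eq_or_ne y 0 with rfl | hy
  · simp
  rw [mul_cpow_of_arg (by exact_mod_cast hr.ne') hy ?_, ofReal_cpow_half hr.le]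
  rw [Complex.arg_ofReal_of_nonneg hr.le, zero_add]
  exact ⟨Complex.neg_pi_lt_arg y, Complex.arg_le_pi y⟩

/-- `(-i w)^{1/2} (i w̄)^{1/2} = |w|` for `Im w > 0` (both factors have positive real part).
[folklore] -/
theorem cpow_half_mul_cpow_half_conj {w₁ : ℂ} (hw : 0 < w₁.im) :
    (-I * w₁) ^ (1 / 2 : ℂ) * (I * conj w₁) ^ (1 / 2 : ℂ) =
      (Real.sqrt (Complex.normSq w₁) : ℂ) := by
  have hx : (-I * w₁).re = w₁.im := by simp
  have hy : (I * conj w₁).re = w₁.im := by simp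
  have hx0 : -I * w₁ ≠ 0 := fun h ↦ by
    have := congrArg Complex.re h; rw [hx] at this; simp at this; linarith
  have hy0 : I * conj w₁ ≠ 0 := fun h ↦ by
    have := congrArg Complex.re h; rw [hy] at this; simp at this; linarith
  rw [← mul_cpow_of_arg hx0 hy0 (arg_add_arg_mem_of_re_pos (by rw [hx]; exact hw)
    (by rw [hy]; exact hw))]
  have : -I * w₁ * (I * conj w₁) = ((Complex.normSq w₁ : ℝ) : ℂ) := by
    rw [show -I * w₁ * (I * conj w₁) = -(I * I) * (w₁ * conj w₁) by ring, I_mul_I, neg_neg,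
      one_mul, Complex.mul_conj]
  rw [this, ofReal_cpow_half (Complex.normSq_nonneg _)]

/-- `((x)^{1/2})² = x`. [folklore] -/
theorem cpow_half_sq (x : ℂ) : (x ^ (1 / 2 : ℂ)) ^ 2 = x := by
  have : (1 / 2 : ℂ) = ((2 : ℕ) : ℂ)⁻¹ := by norm_num
  rw [this, Complex.cpow_nat_inv_pow _ two_ne_zero]

/-! ### The constants at `σ = (a b; 256 d)` -/

section Constants

variable (D : ℕ) [NeZero D]

/-- `w₁ = 256 z + d`. [folklore] -/
def w1 (d : ℤ) (z : ℍ) : ℂ := 256 * (z : ℂ) + d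

/-- `r = 256 N |w₁|²`, `N = 256 D`. [folklore] -/
def rZ (d : ℤ) (z : ℍ) : ℝ := 256 * (256 * D : ℕ) * Complex.normSq (w1 d z)

omit [NeZero D] in
/-- `w₁ = 256 z + d` has positive imaginary part. [folklore] -/
theorem im_w1_pos (d : ℤ) (z : ℍ) : 0 < (w1 d z).im := by
  have : (w1 d z).im = 256 * z.im := by simp [w1]
  rw [this]; exact mul_pos (by norm_num) z.im_pos

omit [NeZero D] in
/-- `w₁ ≠ 0`. [folklore] -/
theorem w1_ne_zero (d : ℤ) (z : ℍ) : w1 d z ≠ 0 := fun h ↦ by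
  have := im_w1_pos d z; rw [h] at this; simp at this

/-- `r > 0`. [folklore] -/
theorem rZ_pos (d : ℤ) (z : ℍ) : 0 < rZ D d z := by
  unfold rZ
  have h1 : (0 : ℝ) < (256 * D : ℕ) := by exact_mod_cast Nat.pos_of_ne_zero (NeZero.ne _)
  have h2 := Complex.normSq_pos.mpr (w1_ne_zero d z)
  positivity

/-- The point `Z' = -1/(256 N w₁)`. [folklore] -/
theorem coe_Z' (d : ℤ) (z : ℍ) :
    ((invFour (auxW (256 * D) 256 d z) : ℍ) : ℂ) = -1 / (256 * (256 * D : ℕ) * w1 d z) := by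
  rw [coe_invFour_auxW, w1]; push_cast; ring

/-- `a_S(Z') = (4/r)(-i w₁)`. [folklore] -/
theorem aS_Z' (d : ℤ) (z : ℍ) :
    aS (invFour (auxW (256 * D) 256 d z)) = ((4 / rZ D d z : ℝ) : ℂ) * (-I * w1 d z) := by
  have hw0 := w1_ne_zero d z
  have hcw0 : conj (w1 d z) ≠ 0 := (map_ne_zero _).mpr hw0
  have hN0 : ((256 * D : ℕ) : ℂ) ≠ 0 := by exact_mod_cast NeZero.ne (256 * D)
  have hnsq : ((Complex.normSq (w1 d z) : ℝ) : ℂ) = w1 d z * conj (w1 d z) :=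
    (Complex.mul_conj (w1 d z)).symm
  have hconj : conj (-1 / (256 * ((256 * D : ℕ) : ℂ) * w1 d z)) =
      -1 / (256 * ((256 * D : ℕ) : ℂ) * conj (w1 d z)) := by
    rw [map_div₀, map_mul, map_mul, map_neg, map_one, map_natCast, map_ofNat]
  rw [aS, coe_Z', hconj, rZ]
  push_cast
  rw [hnsq]
  field_simp

/-- `a_B(Z') = (2/r)(i w̄₁)`. [folklore] -/
theorem aB_Z' (d : ℤ) (z : ℍ) :
    aB (invFour (auxW (256 * D) 256 d z)) = ((2 / rZ D d z : ℝ) : ℂ) * (I * conj (w1 d z)) := by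
  have hw0 := w1_ne_zero d z
  have hcw0 : conj (w1 d z) ≠ 0 := (map_ne_zero _).mpr hw0
  have hN0 : ((256 * D : ℕ) : ℂ) ≠ 0 := by exact_mod_cast NeZero.ne (256 * D)
  have hnsq : ((Complex.normSq (w1 d z) : ℝ) : ℂ) = w1 d z * conj (w1 d z) :=
    (Complex.mul_conj (w1 d z)).symm
  rw [aB, coe_Z', rZ]
  push_cast
  rw [hnsq]
  field_simp

/-- `a_T(Z') = (4/r)(i w̄₁)`. [folklore] -/
theorem aT_Z' (d : ℤ) (z : ℍ) :
    aT (invFour (auxW (256 * D) 256 d z)) = ((4 / rZ D d z : ℝ) : ℂ) * (I * conj (w1 d z)) := by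
  have hw0 := w1_ne_zero d z
  have hcw0 : conj (w1 d z) ≠ 0 := (map_ne_zero _).mpr hw0
  have hN0 : ((256 * D : ℕ) : ℂ) ≠ 0 := by exact_mod_cast NeZero.ne (256 * D)
  have hnsq : ((Complex.normSq (w1 d z) : ℝ) : ℂ) = w1 d z * conj (w1 d z) :=
    (Complex.mul_conj (w1 d z)).symm
  rw [aT, coe_Z', rZ]
  push_cast
  rw [hnsq]
  field_simp

/-- `1/(2Z') = -256 N w₁/2`. [folklore] -/
theorem one_div_two_Z' (d : ℤ) (z : ℍ) :
    1 / (2 * ((invFour (auxW (256 * D) 256 d z) : ℍ) : ℂ)) = -(256 * (256 * D : ℕ) * w1 d z) / 2 := by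
  have hw0 := w1_ne_zero d z
  have hN0 : ((256 * D : ℕ) : ℂ) ≠ 0 := by exact_mod_cast NeZero.ne (256 * D)
  rw [coe_Z']
  field_simp

end Constants

section Law

variable (D : ℕ) [NeZero D]

omit [NeZero D] in
/-- `β = (i w̄₁)^{1/2} ≠ 0`. [folklore] -/
theorem beta_ne_zero (d : ℤ) (z : ℍ) : (I * conj (w1 d z)) ^ (1 / 2 : ℂ) ≠ 0 := by
  rw [Ne, Complex.cpow_eq_zero_iff, not_and_or]
  left
  exact mul_ne_zero I_ne_zero ((map_ne_zero _).mpr (w1_ne_zero d z))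

omit [NeZero D] in
/-- `ρ² = -i w₁ β²` (`ρ = |w₁| = α β`, `α² = -i w₁`). [folklore] -/
theorem rho_sq_eq (d : ℤ) (z : ℍ) :
    ((Real.sqrt (Complex.normSq (w1 d z)) : ℂ)) ^ 2 =
      -I * w1 d z * ((I * conj (w1 d z)) ^ (1 / 2 : ℂ)) ^ 2 := by
  rw [← cpow_half_mul_cpow_half_conj (im_w1_pos d z), mul_pow, cpow_half_sq]

/-- **`κ(Z')`**: `κ(Z') · 8√2 β = -(256N)² √(256N) w₁ |w₁|²`. [folklore] -/
theorem kappa_Z'_mul (d : ℤ) (z : ℍ) :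
    kappa (invFour (auxW (256 * D) 256 d z)) *
        (8 * (Real.sqrt 2 : ℂ) * (I * conj (w1 d z)) ^ (1 / 2 : ℂ)) =
      -(((256 * (256 * D : ℕ) : ℝ) : ℂ)) ^ 2 * (Real.sqrt (256 * (256 * D : ℕ)) : ℂ) * w1 d z *
        (Complex.normSq (w1 d z) : ℂ) := by
  have hr := rZ_pos D d z
  set ρ : ℝ := Real.sqrt (Complex.normSq (w1 d z)) with hρ
  set sM : ℝ := Real.sqrt (256 * (256 * D : ℕ)) with hsM
  have hρ0 : 0 < ρ := Real.sqrt_pos.mpr (Complex.normSq_pos.mpr (w1_ne_zero d z))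
  have hM0 : (0 : ℝ) < 256 * (256 * D : ℕ) := by
    have : (0 : ℝ) < (256 * D : ℕ) := by exact_mod_cast Nat.pos_of_ne_zero (NeZero.ne _)
    positivity
  have hsM0 : 0 < sM := Real.sqrt_pos.mpr hM0
  have hsr : Real.sqrt (rZ D d z) = sM * ρ := by
    rw [rZ]; exact Real.sqrt_mul hM0.le _
  have hs4 : Real.sqrt 4 = 2 := by
    rw [show (4 : ℝ) = 2 ^ 2 by norm_num]; exact Real.sqrt_sq (by norm_num)
  have h4 : Real.sqrt (4 / rZ D d z) = 2 / (sM * ρ) := by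
    rw [Real.sqrt_div' _ hr.le, hs4, hsr]
  have h2 : Real.sqrt (2 / rZ D d z) = Real.sqrt 2 / (sM * ρ) := by
    rw [Real.sqrt_div' _ hr.le, hsr]
  have hαβ := cpow_half_mul_cpow_half_conj (im_w1_pos d z)
  have hβ := beta_ne_zero d z
  set β : ℂ := (I * conj (w1 d z)) ^ (1 / 2 : ℂ) with hβdef
  set α : ℂ := (-I * w1 d z) ^ (1 / 2 : ℂ) with hαdef
  have hα : α = (ρ : ℂ) / β := by rw [eq_div_iff hβ]; exact hαβ
  have hs2 : (Real.sqrt 2 : ℂ) ≠ 0 := by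
    exact_mod_cast (Real.sqrt_pos.mpr (by norm_num : (0:ℝ) < 2)).ne'
  have hnsq : ((Complex.normSq (w1 d z) : ℝ) : ℂ) = (ρ : ℂ) ^ 2 := by
    rw [hρ]; exact_mod_cast (Real.sq_sqrt (Complex.normSq_nonneg _)).symm
  have hρ0' : (ρ : ℂ) ≠ 0 := by exact_mod_cast hρ0.ne'
  have hsM0' : (sM : ℂ) ≠ 0 := by exact_mod_cast hsM0.ne'
  have hsMsq : ((sM : ℂ)) ^ 2 = 256 * (256 * (D : ℂ)) := by
    rw [hsM]; exact_mod_cast Real.sq_sqrt hM0.le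
  unfold kappa
  rw [one_div_two_Z', aS_Z', aB_Z', aT_Z', cpow_half_ofReal_mul (by positivity),
    cpow_half_ofReal_mul (by positivity), cpow_half_ofReal_mul (by positivity), h4, h2,
    ← hαdef, ← hβdef, hα, hnsq]
  push_cast
  field_simp
  linear_combination (-(D : ℂ) * w1 d z * 8) * hsMsq

omit [NeZero D] in
/-- **The `θ`-side factor**: `(2i·256/(256z+d))^{-1/2} = |w₁| / (16 √2 β)`. [folklore] -/
theorem thetaFactor_sigma (d : ℤ) (z : ℍ) :
    1 / (2 * I * ((256 : ℕ) : ℂ) / (((256 : ℕ) : ℂ) * z + d)) ^ (1 / 2 : ℂ) =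
      (Real.sqrt (Complex.normSq (w1 d z)) : ℂ) /
        (16 * Real.sqrt 2 * (I * conj (w1 d z)) ^ (1 / 2 : ℂ)) := by
  have hw0 := w1_ne_zero d z
  have hcw0 : conj (w1 d z) ≠ 0 := (map_ne_zero _).mpr hw0
  have hn0 : (0 : ℝ) < Complex.normSq (w1 d z) := Complex.normSq_pos.mpr hw0
  have hβ := beta_ne_zero d z
  have key : 2 * I * ((256 : ℕ) : ℂ) / (((256 : ℕ) : ℂ) * z + d) =
      ((512 / Complex.normSq (w1 d z) : ℝ) : ℂ) * (I * conj (w1 d z)) := by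
    have hnsq : ((Complex.normSq (w1 d z) : ℝ) : ℂ) = w1 d z * conj (w1 d z) :=
      (Complex.mul_conj _).symm
    rw [show (((256 : ℕ) : ℂ) * z + d) = w1 d z by simp [w1]]
    push_cast
    rw [hnsq]
    field_simp
    ring
  have hs512 : Real.sqrt 512 = 16 * Real.sqrt 2 := by
    rw [show (512 : ℝ) = 16 ^ 2 * 2 by norm_num, Real.sqrt_mul (by norm_num), Real.sqrt_sq (by norm_num)]
  rw [key, cpow_half_ofReal_mul (by positivity), Real.sqrt_div' _ hn0.le, hs512]
  have hρ0 : (Real.sqrt (Complex.normSq (w1 d z)) : ℂ) ≠ 0 := by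
    exact_mod_cast (Real.sqrt_pos.mpr hn0).ne'
  have hs2 : (Real.sqrt 2 : ℂ) ≠ 0 := by
    exact_mod_cast (Real.sqrt_pos.mpr (by norm_num : (0:ℝ) < 2)).ne'
  push_cast
  field_simp

/-- Characters at `a` and `a*` modulo `4`: `ψ₄(a) = ±i` with `χ₄(-a*) = ∓1` (`a a* ≡ 1 (mod 4)`).
[folklore] -/
theorem chars_mod_four {a a' : ℤ} (ha : Odd a) (h4 : (a : ZMod 4) * (a' : ZMod 4) = 1) :
    ((ZMod.stdAddChar (a : ZMod 4) : ℂ) = I ∧ ((ZMod.χ₄ (-a' : ℤ) : ℤ) : ℂ) = -1) ∨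
    ((ZMod.stdAddChar (a : ZMod 4) : ℂ) = -I ∧ ((ZMod.χ₄ (-a' : ℤ) : ℤ) : ℂ) = 1) := by
  have hcases : (a : ZMod 4) = 1 ∨ (a : ZMod 4) = 3 := by
    have h2 : a % 2 = 1 := Int.odd_iff.mp ha
    have : a % 4 = 1 ∨ a % 4 = 3 := by omega
    rcases this with h | h
    · left; rw [← ZMod.intCast_mod a 4, show a % ((4 : ℕ) : ℤ) = 1 by exact_mod_cast h]; rfl
    · right; rw [← ZMod.intCast_mod a 4, show a % ((4 : ℕ) : ℤ) = 3 by exact_mod_cast h]; rfl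
  have hneg : ((-a' : ℤ) : ZMod 4) = -(a' : ZMod 4) := by push_cast; ring
  rcases hcases with h | h
  · left
    rw [h, one_mul] at h4
    refine ⟨by rw [h]; exact stdAddChar_four_one, ?_⟩
    rw [hneg, h4, show ZMod.χ₄ (-1 : ZMod 4) = -1 by decide]
    push_cast
    ring
  · right
    rw [h] at h4
    have ha' : (a' : ZMod 4) = 3 := by
      revert h4; generalize (a' : ZMod 4) = x; decide +revert
    refine ⟨by rw [h]; exact stdAddChar_four_three, ?_⟩
    rw [hneg, ha', show ZMod.χ₄ (-3 : ZMod 4) = 1 by decide]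
    push_cast
    ring

omit [NeZero D] in
/-- `(-a*/D)(a/D) = 1` for `a a* ≡ 1 (mod D)`, `D ≡ 1 (mod 4)`. [folklore] -/
theorem jacobi_prod_eq_one (hD1 : D % 4 = 1) {a a' : ℤ} (hDm : ((a * a' : ℤ) : ZMod D) = 1) :
    (jacobiSym (-a') D : ℤ) * jacobiSym a D = 1 := by
  have hodd : Odd D := Nat.odd_iff.mpr (by omega)
  rw [← jacobiSym.mul_left]
  have hmod : (-a' * a : ℤ) ≡ -1 [ZMOD D] := by
    have h1 : (a * a' : ℤ) ≡ 1 [ZMOD D] := by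
      rw [← ZMod.intCast_eq_intCast_iff]
      push_cast at hDm ⊢
      exact hDm
    have := h1.neg
    rw [show -(a * a') = -a' * a by ring] at this
    exact this
  rw [jacobiSym.mod_left, hmod, ← jacobiSym.mod_left, jacobiSym.at_neg_one hodd,
    ZMod.χ₄_nat_mod_four, hD1]
  decide

/-- **The constant identity at `σ = (a b; 256 d)`** (`D ≡ 1 (mod 4)` square-free, `gcd(a, D) = 1`,
`a a* ≡ 1 (mod 4D)`): the constant produced by the Poisson step equals the cube of the
`θ`-multiplier. [folklore] -/
theorem const_identity (hD1 : D % 4 = 1) {a a' d : ℤ} (haD : a.gcd D = 1) (ha : Odd a)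
    (h4 : (a : ZMod 4) * (a' : ZMod 4) = 1) (hDm : ((a * a' : ℤ) : ZMod D) = 1) (z : ℍ) :
    (Real.sqrt (z.im / Complex.normSq (w1 d z)) : ℂ) *
        ((((8192 * ((256 * D : ℕ) : ℝ) ^ 3)⁻¹ : ℝ) : ℂ) * kappa (invFour (auxW (256 * D) 256 d z)) *
          (((128 * (256 * D : ℕ) : ℝ) : ℂ))⁻¹) *
        (evalConst D a a' * ((Real.sqrt z.im : ℂ))⁻¹) =
      (1 / (2 * I * ((256 : ℕ) : ℂ) / (((256 : ℕ) : ℂ) * z + d)) ^ (1 / 2 : ℂ) *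
        quadGaussSum 256 a 0) ^ 3 := by
  -- atoms
  have hw0 := w1_ne_zero d z
  have hn0 : (0 : ℝ) < Complex.normSq (w1 d z) := Complex.normSq_pos.mpr hw0
  set ρ : ℝ := Real.sqrt (Complex.normSq (w1 d z)) with hρ
  have hρ0 : 0 < ρ := Real.sqrt_pos.mpr hn0
  set β : ℂ := (I * conj (w1 d z)) ^ (1 / 2 : ℂ) with hβdef
  have hβ : β ≠ 0 := beta_ne_zero d z
  set sD : ℝ := Real.sqrt D with hsD
  have hD0 : (0 : ℝ) < D := by exact_mod_cast Nat.pos_of_ne_zero (NeZero.ne D)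
  have hsD0 : 0 < sD := Real.sqrt_pos.mpr hD0
  have hsDsq : ((sD : ℂ)) ^ 2 = D := by rw [hsD]; exact_mod_cast Real.sq_sqrt hD0.le
  set sy : ℝ := Real.sqrt z.im with hsy
  have hsy0 : 0 < sy := Real.sqrt_pos.mpr z.im_pos
  have hs2 : (0 : ℝ) < Real.sqrt 2 := Real.sqrt_pos.mpr (by norm_num)
  have hs2sq : ((Real.sqrt 2 : ℂ)) ^ 2 = 2 := by exact_mod_cast Real.sq_sqrt (by norm_num : (0:ℝ) ≤ 2)
  -- the pieces
  have hκ := kappa_Z'_mul D d z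
  have hsM : Real.sqrt (256 * (256 * D : ℕ)) = 256 * sD := by
    rw [show ((256 * (256 * D : ℕ) : ℝ)) = 256 ^ 2 * D by push_cast; ring,
      Real.sqrt_mul (by norm_num), Real.sqrt_sq (by norm_num)]
  rw [hsM] at hκ
  have hκ' : kappa (invFour (auxW (256 * D) 256 d z)) =
      -(((256 * (256 * D : ℕ) : ℝ) : ℂ)) ^ 2 * ((256 * sD : ℝ) : ℂ) * w1 d z *
        (Complex.normSq (w1 d z) : ℂ) / (8 * (Real.sqrt 2 : ℂ) * β) := by
    rw [eq_div_iff (by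
      refine mul_ne_zero (mul_ne_zero (by norm_num) ?_) hβ
      exact_mod_cast hs2.ne')]
    exact hκ
  have him : Real.sqrt (z.im / Complex.normSq (w1 d z)) = sy / ρ := by
    rw [Real.sqrt_div' _ hn0.le]
  have hnsq : ((Complex.normSq (w1 d z) : ℝ) : ℂ) = (ρ : ℂ) ^ 2 := by
    rw [hρ]; exact_mod_cast (Real.sq_sqrt (Complex.normSq_nonneg _)).symm
  have hR := rho_sq_eq d z
  rw [← hρ, ← hβdef] at hR
  have hJ : ((jacobiSym (-a') D : ℤ) : ℂ) * jacobiSym a D = 1 := by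
    exact_mod_cast jacobi_prod_eq_one D hD1 hDm
  rw [him, hκ', evalConst, quadGaussSum_sixtyfour_mul D hD1 haD, quadGaussSum_256_of_odd ha,
    thetaFactor_sigma, hnsq, ← hρ, ← hβdef]
  rcases chars_mod_four ha h4 with ⟨hψ, hχ⟩ | ⟨hψ, hχ⟩
  · rw [hψ, hχ]
    push_cast
    rw [← hsD]
    have hρ0' : (ρ : ℂ) ≠ 0 := by exact_mod_cast hρ0.ne'
    have hsy0' : (sy : ℂ) ≠ 0 := by exact_mod_cast hsy0.ne'
    have hs20 : (Real.sqrt 2 : ℂ) ≠ 0 := by exact_mod_cast hs2.ne'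
    have hsD0' : (sD : ℂ) ≠ 0 := by exact_mod_cast hsD0.ne'
    have hD0' : (D : ℂ) ≠ 0 := by exact_mod_cast hD0.ne'
    field_simp
    linear_combination (65536 * (sD : ℂ) ^ 2 * w1 d z * (Real.sqrt 2 : ℂ) ^ 2 * β ^ 2 * I +
        65536 * (sD : ℂ) ^ 2 * w1 d z * (Real.sqrt 2 : ℂ) ^ 2 * β ^ 2) * hJ +
      (65536 * (sD : ℂ) ^ 2 * w1 d z * β ^ 2 * (I + 1)) * hs2sq +
      (131072 * w1 d z * β ^ 2 * (I + 1)) * hsDsq +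
      (-(D : ℂ) * (196608 * I + 196608 * I ^ 2 + 65536 * I ^ 3 + 65536)) * hR +
      ((D : ℂ) * w1 d z * β ^ 2 * (65536 * I ^ 2 + 196608 * I + 131072)) * Complex.I_sq
  · rw [hψ, hχ]
    push_cast
    rw [← hsD]
    have hρ0' : (ρ : ℂ) ≠ 0 := by exact_mod_cast hρ0.ne'
    have hsy0' : (sy : ℂ) ≠ 0 := by exact_mod_cast hsy0.ne'
    have hs20 : (Real.sqrt 2 : ℂ) ≠ 0 := by exact_mod_cast hs2.ne'
    have hsD0' : (sD : ℂ) ≠ 0 := by exact_mod_cast hsD0.ne'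
    have hD0' : (D : ℂ) ≠ 0 := by exact_mod_cast hD0.ne'
    field_simp
    linear_combination (65536 * (sD : ℂ) ^ 2 * w1 d z * (Real.sqrt 2 : ℂ) ^ 2 * β ^ 2 * (I - 1)) * hJ +
      (65536 * (sD : ℂ) ^ 2 * w1 d z * β ^ 2 * (I - 1)) * hs2sq +
      (131072 * w1 d z * β ^ 2 * (I - 1)) * hsDsq +
      ((D : ℂ) * (196608 * I - 196608 * I ^ 2 + 65536 * I ^ 3 - 65536)) * hR +
      ((D : ℂ) * w1 d z * β ^ 2 * (-65536 * I ^ 2 + 196608 * I - 131072)) * Complex.I_sq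

end Law

section Assembly

variable (D : ℕ) [NeZero D]

open CongruenceSubgroup

/-- **The `σ`-law**: `K_D(w, σz) θ(z)³ = θ(σz)³ K_D(w, z)` for `σ = (a b; 256 d)` with
`gcd(a, D) = 1` (`D ≡ 1 (mod 4)` square-free). [cite: Shintani1975, Prop. 1.6] -/
theorem kerD_sigma_law (hsq : Squarefree D) (hD1 : D % 4 = 1) (σ : SL(2, ℤ))
    (hc : (σ 1 0 : ℤ) = 256) (haD : (σ 0 0 : ℤ).gcd D = 1) (w z : ℍ) :
    kerD D w (σ • z) * shimuraTheta z ^ 3 = shimuraTheta (σ • z) ^ 3 * kerD D w z := by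
  have hodd : Odd D := Nat.odd_iff.mpr (by omega)
  have hdet := det_eq_one' σ
  rw [hc] at hdet
  have ha : Odd (σ 0 0 : ℤ) := by
    by_contra h
    rw [Int.not_odd_iff_even] at h
    obtain ⟨k, hk⟩ := h
    rw [hk] at hdet
    have : (2 : ℤ) ∣ 1 := ⟨k * σ 1 1 - σ 0 1 * 128, by linear_combination (-1 : ℤ) * hdet⟩
    omega
  -- `a*` modulo `256 D`
  have hcopZ : IsCoprime (σ 0 0 : ℤ) ((256 * D : ℕ) : ℤ) := by
    have h2 : IsCoprime (σ 0 0 : ℤ) 2 := by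
      obtain ⟨k, hk⟩ := ha
      exact ⟨1, -k, by rw [hk]; ring⟩
    have h256 : IsCoprime (σ 0 0 : ℤ) ((2 : ℤ) ^ 8) := h2.pow_right
    have hD : IsCoprime (σ 0 0 : ℤ) (D : ℤ) := Int.isCoprime_iff_gcd_eq_one.mpr haD
    have := h256.mul_right hD
    push_cast
    norm_num at this
    exact this
  have hunit : IsUnit ((σ 0 0 : ℤ) : ZMod (256 * D)) := by
    rw [ZMod.coe_int_isUnit_iff_isCoprime]; exact hcopZ.symm
  obtain ⟨u, hu⟩ := hunit
  set a' : ℤ := (((u⁻¹ : (ZMod (256 * D))ˣ) : ZMod (256 * D)).val : ℤ) with ha'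
  have haa' : ((σ 0 0 : ℤ) : ZMod (256 * D)) * (a' : ZMod (256 * D)) = 1 := by
    rw [ha', Int.cast_natCast, ZMod.natCast_zmod_val, ← hu, Units.mul_inv]
  have h4 : ((σ 0 0 : ℤ) : ZMod 4) * (a' : ZMod 4) = 1 := by
    have := congrArg (ZMod.castHom (show 4 ∣ 256 * D from dvd_mul_of_dvd_left (by norm_num) D)
      (ZMod 4)) haa'
    rw [map_mul, map_one, map_intCast, map_intCast] at this
    exact this
  have hDm : (((σ 0 0 : ℤ) * a' : ℤ) : ZMod D) = 1 := by
    have := congrArg (ZMod.castHom (dvd_mul_left D 256) (ZMod D)) haa'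
    rw [map_mul, map_one, map_intCast, map_intCast] at this
    push_cast
    exact this
  haveI : NeZero (256 : ℕ) := ⟨by norm_num⟩
  have hK := kerD_smul_sigma D hsq hodd σ hc a' haa' w z
  have hθ : shimuraTheta (σ • z) =
      1 / (2 * I * ((256 : ℕ) : ℂ) / (((256 : ℕ) : ℂ) * z + (σ 1 1 : ℤ))) ^ (1 / 2 : ℂ) *
        quadGaussSum 256 (σ 0 0 : ℤ) 0 * shimuraTheta z := by
    rw [← thetaMul_one_eq_shimuraTheta, ← thetaMul_one_eq_shimuraTheta]
    exact thetaMul_one_smul hc (by norm_num) z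
  have him : (σ • z).im = z.im / Complex.normSq (w1 (σ 1 1) z) := by
    rw [ModularGroup.im_smul_eq_div_normSq, ModularGroup.denom_apply]
    congr 2
    rw [w1, hc]
    push_cast
    ring
  have hstar := const_identity D hD1 (d := σ 1 1) haD ha h4 hDm z
  rw [hK, hθ, him]
  linear_combination (kerD D w z * shimuraTheta z ^ 3) * hstar

/-- **The `T`-law**: `K_D(w, z + 1) = K_D(w, z)` (`D` square-free): on the support of the weight
the exponents `disc ι♮(k)/(256D) = n(v)/D` are integers. [folklore] -/
theorem kerD_T_smul (hsq : Squarefree D) (w z : ℍ) :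
    kerD D w (ModularGroup.T • z) = kerD D w z := by
  rw [UpperHalfPlane.modular_T_smul]
  unfold kerD
  apply genKernel_vadd_of_int
  intro k hk
  by_cases h128 : (128 : ℤ) ∣ k 1
  · obtain ⟨k1, hk1⟩ := h128
    have hke : k = embedSharp ![k 0, k1, k 2] := by
      funext i; fin_cases i <;> simp [embedSharp, hk1]
    rw [hke, cD_embedSharp] at hk
    have hne : genusWt D ![k 0, k1, k 2] ≠ 0 := fun h0 ↦ by apply hk; rw [h0]; simp
    have hDn : (D : ℤ) ∣ nQ ![k 0, k1, k 2] := by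
      by_contra h; exact hne (genusWt_of_not_dvd hsq h)
    obtain ⟨m, hm⟩ := hDn
    refine ⟨m, ?_⟩
    rw [hke, latSharp_embedSharp, disc_latFun, hm]
    have hD0 : (D : ℝ) ≠ 0 := by exact_mod_cast NeZero.ne D
    push_cast
    field_simp
  · exact absurd (cD_of_not_dvd h128) hk

/-- Continuity of `z ↦ f_{w, tz}(x)`. [folklore] -/
theorem continuous_shintaniFn_mulPos (w : ℍ) (t : ℝ) (ht : 0 < t) (x : V) :
    Continuous fun z : ℍ ↦ shintaniFn w (mulPos t ht z) x := by
  have hcoe : Continuous fun z : ℍ ↦ ((mulPos t ht z : ℍ) : ℂ) := by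
    simp_rw [coe_mulPos]; fun_prop
  have hG : Continuous fun u : ℂ ↦ formEval x w *
      cexp (2 * π * I * ((u.re : ℂ) * disc x + I * ((u.im : ℂ) * majorant w x))) := by
    fun_prop
  exact hG.comp hcoe

/-- `majorant_w(x) ≥ 0`. [folklore] -/
theorem majorant_nonneg (w : ℍ) (x : V) : 0 ≤ majorant w x := by
  obtain ⟨c, hc, hcx⟩ := exists_pos_mul_norm_sq_le_majorant w
  exact le_trans (by positivity) (hcx x)

open Literature.NumberTheory.LFunctions.Fourier (summable_one_add_norm_rpow_neg) in
/-- **Continuity of the generalized kernels in `z`** (dominated convergence on `Im z > y₀`: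
`|f_{w,Z}(x)|` is decreasing in `Im Z`). [folklore] -/
theorem continuous_genKernel {c : (Fin 3 → ℤ) → ℂ} (hc : BddWeight c) (t : ℝ) (ht : 0 < t) (w : ℍ) :
    Continuous fun z : ℍ ↦ genKernel c t ht w z := by
  have hsqrt : Continuous fun z : ℍ ↦ ((Real.sqrt z.im : ℝ) : ℂ) :=
    Complex.continuous_ofReal.comp (Real.continuous_sqrt.comp UpperHalfPlane.continuous_im)
  suffices hS : Continuous fun z : ℍ ↦ ∑' k : Fin 3 → ℤ, c k * shintaniFn w (mulPos t ht z) (latSharp k) by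
    unfold genKernel; exact hsqrt.mul hS
  rw [continuous_iff_continuousAt]
  intro z₀
  set y : ℝ := z₀.im / 2 with hy
  have hy0 : 0 < y := by have := z₀.im_pos; positivity
  set z₁ : ℍ := ⟨(y : ℂ) * I, by simpa using hy0⟩ with hz₁
  have hz₁im : z₁.im = y := by simp [hz₁, UpperHalfPlane.im]
  set U : Set ℍ := {z : ℍ | y < z.im} with hU
  have hUo : IsOpen U := isOpen_lt continuous_const UpperHalfPlane.continuous_im
  have hz₀U : z₀ ∈ U := by simp only [hU, Set.mem_setOf_eq, hy]; linarith [z₀.im_pos]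
  -- dominating sequence
  obtain ⟨C', hC'⟩ := norm_term_le hc w (mulPos t ht z₁)
  have hbound : ∀ (k : Fin 3 → ℤ) (z : ℍ), z ∈ U →
      ‖c k * shintaniFn w (mulPos t ht z) (latSharp k)‖ ≤
        ‖c k * shintaniFn w (mulPos t ht z₁) (latSharp k)‖ := by
    intro k z hz
    rw [norm_mul, norm_mul, norm_shintaniFn, norm_shintaniFn, im_mulPos, im_mulPos, hz₁im]
    refine mul_le_mul_of_nonneg_left (mul_le_mul_of_nonneg_left ?_ (norm_nonneg _)) (norm_nonneg _)
    apply Real.exp_le_exp.mpr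
    have hm := majorant_nonneg w (latSharp k)
    have hz' : y ≤ z.im := le_of_lt hz
    have : t * y * majorant w (latSharp k) ≤ t * z.im * majorant w (latSharp k) := by
      apply mul_le_mul_of_nonneg_right _ hm
      exact mul_le_mul_of_nonneg_left hz' ht.le
    linarith [Real.pi_pos, mul_le_mul_of_nonneg_left this (by positivity : (0:ℝ) ≤ 2 * π)]
  have hsum : Summable fun k : Fin 3 → ℤ ↦ ‖c k * shintaniFn w (mulPos t ht z₁) (latSharp k)‖ :=
    Summable.of_nonneg_of_le (fun _ ↦ norm_nonneg _) hC'
      ((summable_one_add_norm_rpow_neg (ι := Fin 3) (b := 4) (by norm_num)).mul_left C')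
  have hcont : ContinuousOn (fun z : ℍ ↦ ∑' k : Fin 3 → ℤ, c k * shintaniFn w (mulPos t ht z) (latSharp k)) U := by
    refine continuousOn_tsum (fun k ↦ ?_) hsum (fun k z hz ↦ hbound k z hz)
    exact (continuous_const.mul (continuous_shintaniFn_mulPos w t ht _)).continuousOn
  exact hcont.continuousAt (hUo.mem_nhds hz₀U)

/-- Continuity of `z ↦ K_D(w, z)`. [folklore] -/
theorem continuous_kerD (w : ℍ) : Continuous fun z : ℍ ↦ kerD D w z :=
  continuous_genKernel (bddWeight_cD D) _ _ w

/-- The generating set used: `T`, `-1`, and the `σ = (a b; 256 d)` with `gcd(a, D) = 1`. [folklore] -/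
def genSetD : Set SL(2, ℤ) :=
  {ModularGroup.T} ∪ {-1} ∪ {σ | (σ 1 0 : ℤ) = 256 ∧ (σ 0 0 : ℤ).gcd D = 1}

omit [NeZero D] in
/-- Entries of `T^k σ`. [folklore] -/
theorem T_zpow_mul_apply (k : ℤ) (σ : SL(2, ℤ)) :
    ((ModularGroup.T ^ k * σ) 1 0 : ℤ) = σ 1 0 ∧ ((ModularGroup.T ^ k * σ) 0 0 : ℤ) = σ 0 0 + k * σ 1 0 := by
  constructor
  · rw [Matrix.SpecialLinearGroup.coe_mul, ModularGroup.coe_T_zpow]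
    simp [Matrix.mul_apply, Fin.sum_univ_two]
  · rw [Matrix.SpecialLinearGroup.coe_mul, ModularGroup.coe_T_zpow]
    simp [Matrix.mul_apply, Fin.sum_univ_two]

omit [NeZero D] in
/-- `Γ₀(256) ≤ ⟨genSetD⟩` (`D` odd): shift `a` by a multiple of `256` into a class prime to `D`.
[folklore] -/
theorem gamma0_le_closure_genSetD (hodd : Odd D) :
    (Gamma0 256 : Set SL(2, ℤ)) ⊆ Subgroup.closure (genSetD D) := by
  intro γ hγ
  have h1 := gamma0_256_le_closure hγ
  have hsub : gamma0GenSet 256 ⊆ (Subgroup.closure (genSetD D) : Set SL(2, ℤ)) := by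
    intro σ hσ
    simp only [gamma0GenSet, Set.mem_union, Set.mem_singleton_iff, Set.mem_setOf_eq] at hσ
    rcases hσ with (rfl | rfl) | hσ
    · exact Subgroup.subset_closure (by simp [genSetD])
    · exact Subgroup.subset_closure (by simp [genSetD])
    · -- `σ 1 0 = 256`: find `k` with `gcd(a + 256 k, D) = 1`
      have hcop : IsCoprime (256 : ℤ) (D : ℤ) := by
        have h2 : IsCoprime (2 : ℤ) (D : ℤ) := by
          rw [Int.isCoprime_iff_gcd_eq_one]
          have := Nat.coprime_two_left.mpr hodd
          exact_mod_cast this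
        have := h2.pow_left (m := 8)
        norm_num at this
        exact this
      obtain ⟨u, v, huv⟩ := hcop
      set k : ℤ := u * (1 - σ 0 0) with hk
      have hcop' : ((σ 0 0 : ℤ) + k * 256).gcd D = 1 := by
        apply Int.isCoprime_iff_gcd_eq_one.mp
        refine ⟨1, (1 - σ 0 0) * v, ?_⟩
        rw [hk]
        linear_combination (1 - (σ 0 0 : ℤ)) * huv
      set σ' := ModularGroup.T ^ k * σ with hσ'
      have h10 : ((σ' 1 0 : ℤ)) = 256 := by rw [hσ', (T_zpow_mul_apply k σ).1, hσ]; rfl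
      have h00 : ((σ' 0 0 : ℤ)).gcd D = 1 := by
        rw [hσ', (T_zpow_mul_apply k σ).2]
        push_cast at hσ
        rw [hσ]
        exact hcop'
      have hmem : σ' ∈ Subgroup.closure (genSetD D) :=
        Subgroup.subset_closure (Or.inr ⟨h10, h00⟩)
      have hT : ModularGroup.T ∈ Subgroup.closure (genSetD D) :=
        Subgroup.subset_closure (by simp [genSetD])
      have : σ = ModularGroup.T ^ (-k) * σ' := by rw [hσ', ← mul_assoc, ← _root_.zpow_add]; simp
      rw [this]
      exact mul_mem (zpow_mem hT _) hmem
  exact ((Subgroup.closure_le _).mpr hsub) h1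

/-- **Automorphy of the twisted Shintani kernel**: for `D` odd and square-free, `z ↦ K_D(w, z)`
satisfies the `θ`-multiplier law of weight `3/2` on `Γ₀(256)` with trivial character.
[cite: Shintani1975, Prop. 1.6] -/
theorem isThetaAutomorphic_kerD (hsq : Squarefree D) (hodd : Odd D) (w : ℍ) :
    IsThetaAutomorphic 3 256 1 (fun z ↦ kerD D w z) := by
  have hχ : ∀ {x : ZMod 256}, IsUnit x → (1 : DirichletCharacter ℂ 256) x = 1 :=
    fun hx ↦ MulChar.one_apply hx
  rcases Nat.odd_mod_four_iff.mp (Nat.odd_iff.mp hodd) with h1 | h3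
  · refine isThetaAutomorphic_of_generators (continuous_kerD D w) (genSetD D) ?_
      (gamma0_le_closure_genSetD D hodd) ?_
    · intro σ hσ
      simp only [genSetD, Set.mem_union, Set.mem_singleton_iff, Set.mem_setOf_eq] at hσ
      simp only [SetLike.mem_coe, Gamma0_mem]
      rcases hσ with (rfl | rfl) | ⟨h10, _⟩
      · simp [ModularGroup.T]
      · simp
      · rw [h10]
        decide
    · intro σ hσ z
      simp only [genSetD, Set.mem_union, Set.mem_singleton_iff, Set.mem_setOf_eq] at hσ
      rcases hσ with (rfl | rfl) | ⟨h10, h00⟩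
      · -- `T`
        simp only
        rw [kerD_T_smul D hsq, shimuraTheta_T_smul]
        have : ((ModularGroup.T 1 1 : ℤ) : ZMod 256) = 1 := by simp [ModularGroup.T]
        rw [this, map_one]; ring
      · -- `-1`
        simp only
        rw [show ((-1 : SL(2, ℤ)) • z) = z from by rw [ModularGroup.SL_neg_smul, one_smul]]
        have : (((-1 : SL(2, ℤ)) 1 1 : ℤ) : ZMod 256) = -1 := by simp
        rw [this, hχ isUnit_one.neg]; ring
      · -- `σ`
        simp only
        have hdet := det_eq_one' σ
        rw [h10] at hdet
        have hd : IsUnit ((σ 1 1 : ℤ) : ZMod 256) := by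
          rw [ZMod.coe_int_isUnit_iff_isCoprime]
          refine ⟨-(σ 0 1 : ℤ), σ 0 0, ?_⟩
          push_cast
          linear_combination hdet
        rw [hχ hd, one_mul]
        exact kerD_sigma_law D hsq h1 σ h10 h00 w z
  · intro γ _ z
    simp only [kerD_eq_zero_of_mod_four hsq h3, zero_mul, mul_zero]

end Assembly

end Literature.NumberTheory.EllipticCurves.Shintani
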